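import Summits.CriticalPhenomena.SAWScalingLimit.Theorems.SAWLeftRightFKGFKGToTraversalBoundOutlineFaces
import Summits.CriticalPhenomena.SAWScalingLimit.Theorems.SAWLeftRightFKGFKGToTraversalBoundOutlineTour
import Literature.Probability.LatticeModels.RandomClusterBoxDuality
import HarnessLib

/-!
# No `abab` alternation of two obstacle classes along the wall-follower tour

Crux `SAWLeftRightFKG.FKGToTraversalBound` (stmt-CriticalPhenomena-1878), line `slit-necklace`, lead
prover-line-stmt-CriticalPhenomena-1878-c5-0; witness unit U2 (abab-freeness of the obstacle contacts of a hugging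
run), on top of `…SlitNecklaceOutline` (`bnext`, `btour`, `bcontact`), `…OutlineTour` (`btour_add`,
`btour_add_of_eq`, `btour_mod_of_eq`) and `…OutlineFaces` (`cornerFace`: the tour as a walk of FACES).

Registered stub `btour_abab`: let `A ⊆ ℤ²` be `4`-connected, `X, Y ⊆ ℤ² ∖ A` disjoint and each `4`-connected,
and let one injective period `[n₁, n₁ + N)` of the wall-follower tour of `A` be given.  Then the contact sites at
four positions `n₁ < n₂ < n₃ < n₄ < n₁ + N` cannot read `X, Y, X, Y`.

The proof is DISCRETE planar topology by the tree's combinatorial winding number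
`Literature.Probability.Percolation.walkWinding` (no Jordan curve theorem, no paths in `ℂ`):
* `abab_loop` — close the `X`-connection of the two `X`-contacts through `A` into a closed lattice TRAIL `Ψ`
  through the primal edge `{x, x + d}` of the first `X`-position; its only `A`–`Aᶜ` edges are the primal edges of
  the two `X`-positions;
* the tour is a face walk crossing exactly the primal edges of its own positions (`cornerFace_btour_succ`,
  `sepEdge_cornerFace`), so `walkWinding Ψ` is constant along the two tour arcs between the `X`-positions
  (`walkWinding_closed_eq_of_adj`), and it JUMPS across the used edge `{x, x + d}`
  (`abab_walkWinding_ne_of_sepEdge_mem`, from `walkWinding_sub_eq_of_vertical_mem` / `…horizontal_mem`): the two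
  arcs carry different winding numbers;
* a `Y`-contact is a corner site of its tour face and lies off `Ψ` (`walkWinding_eq_of_mem_corners`), and the
  `Y`-connection of the two `Y`-contacts avoids `Ψ ⊆ X ∪ A` (`walkWinding_eq_of_walk_closed`): the two arcs carry
  the same winding number — contradiction.

All statements folklore (boundary tracing of a polyomino; Kesten, *Percolation theory for mathematicians* (1982),
§2.2 for the winding-number bookkeeping, already formalised in `PlanarDuality.lean`); no literature fact is
introduced; nothing restates the crux.
-/

noncomputable section

open SimpleGraph
open Literature.Probability.LatticeModels Literature.Probability.Percolation
open Literature.Probability.LatticeModels.SquareTiling (corners walkWinding_eq_of_mem_corners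
  walkWinding_eq_of_walk_closed)

namespace Summit.CriticalPhenomena.SAWScalingLimit.Theorems.FKGToTraversalBound.SlitNecklace

/-! ### Small bookkeeping -/

/-- The unit vectors of distinct directions are distinct. [folklore] -/
private theorem abab_vec_injective {d d' : ODir} (h : d.vec = d'.vec) : d = d' := by
  have h0 := congrFun h 0
  have h1 := congrFun h 1
  fin_cases d <;> fin_cases d' <;> first | rfl | (exfalso; revert h0 h1; simp [ODir.vec])

/-- A boundary edge is determined by its primal edge `{x, x + d}` once the orientation is pinned down
(`x` is not the far endpoint of the other edge). [folklore] -/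
private theorem abab_edge_eq {x x' : Site 2} {d d' : ODir} (hne : x ≠ x' + d'.vec)
    (h : s(x, x + d.vec) = s(x', x' + d'.vec)) : (x, d) = (x', d') := by
  rcases Sym2.eq_iff.1 h with ⟨rfl, h2⟩ | ⟨h1, -⟩
  · rw [abab_vec_injective (add_left_cancel h2)]
  · exact absurd h1 hne

/-- `q + e₀ + e₁ - (1, 1) = q`. [folklore] -/
private theorem abab_add_add_sub_one (q : Site 2) : q + Pi.single 0 1 + Pi.single 1 1 - 1 = q := by
  ext i; fin_cases i <;> simp

/-- A function on `ℕ` with vanishing steps on `[a, b)` is constant on `[a, b]`. [folklore] -/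
private theorem abab_const_of_steps {f : ℕ → ℤ} {a b : ℕ} (h : ∀ j, a ≤ j → j < b → f (j + 1) = f j) :
    ∀ j, a ≤ j → j ≤ b → f j = f a := by
  intro j haj
  induction j, haj using Nat.le_induction with
  | base => exact fun _ => rfl
  | succ n hn ih => exact fun hnb => (h n hn hnb).trans (ih (Nat.le_of_succ_le hnb))

/-- The face step of a boundary edge crosses its primal edge (`sepEdge_cornerFace` for a pair). [folklore] -/
private theorem abab_sepEdge_cornerFace (e : Site 2 × ODir) :
    sepEdge (cornerFace e) (cornerFace e + e.2.ccw.vec) = s(e.1, e.1 + e.2.vec) := by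
  obtain ⟨x, d⟩ := e
  exact sepEdge_cornerFace x d

/-! ### Winding numbers: the jump across a used edge -/

/-- **A closed lattice trail winds differently about the two faces of an edge it uses.** [folklore] -/
theorem abab_walkWinding_ne_of_sepEdge_mem {a : Site 2} {p : (zdGraph 2).Walk a a} (hp : p.edges.Nodup)
    {z z' : Site 2} (hzz : (zdGraph 2).Adj z z') (h : sepEdge z z' ∈ p.edges) :
    walkWinding p z ≠ walkWinding p z' := by
  rcases stepKind_of_adj hzz with ⟨h0, h1⟩ | ⟨h0, h1⟩ | ⟨h1, h0⟩ | ⟨h1, h0⟩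
  · obtain rfl : z' = z + Pi.single 0 1 := by simp [Site.eq_iff_two, h0, h1]
    rw [sepEdge_right] at h
    rcases walkWinding_sub_eq_of_vertical_mem hp h with h' | h' <;> omega
  · obtain rfl : z = z' + Pi.single 0 1 := by simp [Site.eq_iff_two, h0, h1]
    rw [sepEdge_comm, sepEdge_right] at h
    rcases walkWinding_sub_eq_of_vertical_mem hp h with h' | h' <;> omega
  · obtain rfl : z' = z + Pi.single 1 1 := by simp [Site.eq_iff_two, h0, h1]
    rw [sepEdge_up] at h
    rcases walkWinding_sub_eq_of_horizontal_mem hp h with h' | h' <;> omega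
  · obtain rfl : z = z' + Pi.single 1 1 := by simp [Site.eq_iff_two, h0, h1]
    rw [sepEdge_comm, sepEdge_up] at h
    rcases walkWinding_sub_eq_of_horizontal_mem hp h with h' | h' <;> omega

/-! ### The closed trail through the first `X`-edge -/

/-- **The loop.**  From an `X`-walk joining the contacts `x + d`, `x₃ + d₃` of two distinct boundary edges
`(x, d)`, `(x₃, d₃)` of `A` (`X ∩ A = ∅`) and an `A`-walk from `x₃` back to `x`, a closed lattice TRAIL `Ψ` at `x`
with: support in `X ∪ A`; first edge `{x, x + d}`; and whose only edges from a site `y ∈ A` to a site outside `A`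
are the primal edges of `(x, d)` and `(x₃, d₃)`. [folklore] -/
private theorem abab_loop {A X : Set (Site 2)} (hXA : ∀ x ∈ X, x ∉ A) {x x₃ : Site 2} {d d₃ : ODir}
    (hx : x ∈ A) (hc₁ : x + d.vec ∉ A) (hx₃ : x₃ ∈ A) (hc₃ : x₃ + d₃.vec ∉ A) (hne : (x, d) ≠ (x₃, d₃))
    (ωX : (zdGraph 2).Walk (x + d.vec) (x₃ + d₃.vec)) (hωX : ∀ z ∈ ωX.support, z ∈ X)
    (α : (zdGraph 2).Walk x₃ x) (hα : ∀ z ∈ α.support, z ∈ A) :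
    ∃ Ψ : (zdGraph 2).Walk x x,
      (∀ z ∈ Ψ.support, z ∈ X ∨ z ∈ A) ∧ Ψ.edges.Nodup ∧ s(x, x + d.vec) ∈ Ψ.edges ∧
      ∀ (y : Site 2) (d' : ODir), y ∈ A → s(y, y + d'.vec) ∈ Ψ.edges →
        (y, d') = (x, d) ∨ (y, d') = (x₃, d₃) ∨ y + d'.vec ∈ A := by
  classical
  -- pass to paths inside `X` and inside `A`
  set PX := ωX.bypass with hPX
  set PA := α.bypass with hPA
  have hPXs : ∀ z ∈ PX.support, z ∈ X := fun z hz => hωX z (ωX.support_bypass_subset_support hz)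
  have hPAs : ∀ z ∈ PA.support, z ∈ A := fun z hz => hα z (α.support_bypass_subset_support hz)
  have hadj₃ : (zdGraph 2).Adj (x₃ + d₃.vec) x₃ := (ODir.adj_add_vec x₃ d₃).symm
  refine ⟨Walk.cons (ODir.adj_add_vec x d) (PX.append (Walk.cons hadj₃ PA)), ?_, ?_, ?_, ?_⟩
  · -- support
    intro z hz
    rw [Walk.support_cons, List.mem_cons, Walk.mem_support_append_iff, Walk.support_cons, List.mem_cons] at hz
    rcases hz with rfl | hz | rfl | hz
    · exact Or.inr hx
    · exact Or.inl (hPXs z hz)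
    · exact Or.inl (hPXs _ PX.end_mem_support)
    · exact Or.inr (hPAs z hz)
  · -- edges without repetition
    rw [Walk.edges_cons, Walk.edges_append, Walk.edges_cons, List.nodup_cons]
    refine ⟨fun hmem => ?_, ?_⟩
    · rcases List.mem_append.1 hmem with hmem | hmem
      · exact hXA x (hPXs x (PX.fst_mem_support_of_mem_edges hmem)) hx
      rcases List.mem_cons.1 hmem with hmem | hmem
      · rcases Sym2.eq_iff.1 hmem with ⟨h1, -⟩ | ⟨h1, h2⟩
        · exact hc₃ (h1 ▸ hx)
        · exact hne (abab_edge_eq (fun h => hc₃ (h ▸ hx)) (by rw [h2, h1]))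
      · exact hc₁ (hPAs _ (PA.snd_mem_support_of_mem_edges hmem))
    · refine (Walk.bypass_isPath ωX).edges_nodup.append
        (List.nodup_cons.2 ⟨fun hmem => hc₃ (hPAs _ (PA.fst_mem_support_of_mem_edges hmem)),
          (Walk.bypass_isPath α).edges_nodup⟩) ?_
      intro e he₁ he₂
      induction e using Sym2.ind with
      | _ a b =>
        have ha : a ∈ X := hPXs a (PX.fst_mem_support_of_mem_edges he₁)
        have hb : b ∈ X := hPXs b (PX.snd_mem_support_of_mem_edges he₁)
        rcases List.mem_cons.1 he₂ with he₂ | he₂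
        · rcases Sym2.eq_iff.1 he₂ with ⟨-, rfl⟩ | ⟨rfl, -⟩
          · exact hXA _ hb hx₃
          · exact hXA _ ha hx₃
        · exact hXA a ha (hPAs a (PA.fst_mem_support_of_mem_edges he₂))
  · -- the first edge
    rw [Walk.edges_cons]
    exact List.mem_cons_self
  · -- `A`–outside edges of `Ψ`
    intro y d' hy hmem
    rw [Walk.edges_cons, Walk.edges_append, Walk.edges_cons, List.mem_cons] at hmem
    rcases hmem with hmem | hmem
    · exact Or.inl (abab_edge_eq (fun h => hc₁ (h ▸ hy)) hmem)
    rcases List.mem_append.1 hmem with hmem | hmem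
    · exact absurd hy (hXA y (hPXs y (PX.fst_mem_support_of_mem_edges hmem)))
    rcases List.mem_cons.1 hmem with hmem | hmem
    · refine Or.inr (Or.inl (abab_edge_eq (fun h => hc₃ (h ▸ hy)) ?_))
      rw [hmem, Sym2.eq_swap]
    · exact Or.inr (Or.inr (hPAs _ (PA.snd_mem_support_of_mem_edges hmem)))

/-! ### The normalised statement: first `X`-position at the start of the period -/

/-- `btour_abab` with the first `X`-position moved to `0` (and `A` any site set). [folklore] -/
private theorem abab_core (A X Y : Set (Site 2)) (e : Site 2 × ODir) (m₂ m₃ m₄ N : ℕ) (he : IsBEdge A e)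
    (hA : ∀ x ∈ A, ∀ y ∈ A, ∃ p : (zdGraph 2).Walk x y, ∀ z ∈ p.support, z ∈ A)
    (hXA : ∀ x ∈ X, x ∉ A) (hYA : ∀ y ∈ Y, y ∉ A) (hXY : Disjoint X Y)
    (hX : ∀ x ∈ X, ∀ x' ∈ X, ∃ p : (zdGraph 2).Walk x x', ∀ z ∈ p.support, z ∈ X)
    (hY : ∀ y ∈ Y, ∀ y' ∈ Y, ∃ p : (zdGraph 2).Walk y y', ∀ z ∈ p.support, z ∈ Y)
    (h02 : 0 < m₂) (h23 : m₂ < m₃) (h34 : m₃ < m₄) (h4N : m₄ < N) (hN : btour A e N = e)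
    (hinj : ∀ j j', j < N → j' < N → btour A e j = btour A e j' → j = j')
    (h1 : bcontact e ∈ X) (h2 : bcontact (btour A e m₂) ∈ Y) (h3 : bcontact (btour A e m₃) ∈ X)
    (h4 : bcontact (btour A e m₄) ∈ Y) : False := by
  obtain ⟨x, d⟩ := e
  obtain ⟨hx, hc₁A⟩ := he
  simp only at hx hc₁A
  rcases h₃e : btour A (x, d) m₃ with ⟨x₃, d₃⟩
  obtain ⟨hx₃, hc₃A⟩ : IsBEdge A (x₃, d₃) := h₃e ▸ btour_isBEdge A ⟨hx, hc₁A⟩ m₃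
  simp only at hx₃ hc₃A
  rw [h₃e] at h3
  simp only [bcontact] at h1 h3
  have hne : (x, d) ≠ (x₃, d₃) := fun h => by
    have := hinj 0 m₃ (by omega) (by omega) (by rw [btour_zero, h₃e, h])
    omega
  -- the loop
  obtain ⟨ωX, hωX⟩ := hX _ h1 _ h3
  obtain ⟨α, hα⟩ := hA x₃ hx₃ x hx
  obtain ⟨Ψ, hΨs, hΨn, hΨ0, hΨe⟩ := abab_loop hXA hx hc₁A hx₃ hc₃A hne ωX hωX α hα
  have hΨY : ∀ y ∈ Y, y ∉ Ψ.support := fun y hy hmem =>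
    (hΨs y hmem).elim (fun h => Set.disjoint_left.1 hXY h hy) (hYA y hy)
  -- face steps of the tour away from the two `X`-positions do not cross `Ψ`
  have hstep : ∀ j, 0 < j → j < N → j ≠ m₃ →
      walkWinding Ψ (cornerFace (btour A (x, d) (j + 1))) = walkWinding Ψ (cornerFace (btour A (x, d) j)) := by
    intro j hj0 hjN hj3
    rw [cornerFace_btour_succ]
    refine (walkWinding_closed_eq_of_adj (adj_cornerFace_add _) fun hmem => ?_).symm
    rw [abab_sepEdge_cornerFace] at hmem
    rcases hje : btour A (x, d) j with ⟨xj, dj⟩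
    obtain ⟨hxj, hcjA⟩ : IsBEdge A (xj, dj) := hje ▸ btour_isBEdge A ⟨hx, hc₁A⟩ j
    simp only at hxj hcjA
    rw [hje] at hmem
    rcases hΨe xj dj hxj hmem with h | h | h
    · have := hinj j 0 hjN (by omega) (by rw [hje, h, btour_zero])
      omega
    · exact hj3 (hinj j m₃ hjN (by omega) (by rw [hje, h, h₃e]))
    · exact hcjA h
  -- hence the winding number is constant on the two arcs
  have harc1 : ∀ j, 1 ≤ j → j ≤ m₃ →
      walkWinding Ψ (cornerFace (btour A (x, d) j)) = walkWinding Ψ (cornerFace (btour A (x, d) 1)) :=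
    abab_const_of_steps (f := fun j => walkWinding Ψ (cornerFace (btour A (x, d) j)))
      fun j hj hjb => hstep j hj (by omega) (by omega)
  have harc2 : ∀ j, m₃ + 1 ≤ j → j ≤ N →
      walkWinding Ψ (cornerFace (btour A (x, d) j)) = walkWinding Ψ (cornerFace (btour A (x, d) (m₃ + 1))) :=
    abab_const_of_steps (f := fun j => walkWinding Ψ (cornerFace (btour A (x, d) j)))
      fun j hj hjb => hstep j (by omega) hjb (by omega)
  -- the jump across the first edge
  have hjump : walkWinding Ψ (cornerFace (btour A (x, d) 0)) ≠ walkWinding Ψ (cornerFace (btour A (x, d) 1)) := by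
    rw [cornerFace_btour_succ, btour_zero]
    refine abab_walkWinding_ne_of_sepEdge_mem hΨn (adj_cornerFace_add _) ?_
    rw [abab_sepEdge_cornerFace]
    exact hΨ0
  -- a `Y`-contact sees the winding number of its tour face
  have hcontact : ∀ j, bcontact (btour A (x, d) j) ∈ Y →
      walkWinding Ψ (cornerFace (btour A (x, d) j)) = walkWinding Ψ (bcontact (btour A (x, d) j)) := by
    intro j hj
    rcases hje : btour A (x, d) j with ⟨xj, dj⟩
    rw [hje] at hj
    simp only [bcontact] at hj ⊢
    have hq := hΨY _ hj
    have h1 := walkWinding_eq_of_mem_corners Ψ hq (cornerFace_add_one_mem_corners_contact xj dj)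
    have h2 := walkWinding_eq_of_mem_corners Ψ hq
      (c := xj + dj.vec + Pi.single 0 1 + Pi.single 1 1) (by simp [corners])
    rw [add_sub_cancel_right] at h1
    rw [abab_add_add_sub_one] at h2
    exact h1.trans h2.symm
  -- the `Y`-connection does not meet `Ψ`
  obtain ⟨ωY, hωY⟩ := hY _ h2 _ h4
  have hYw := walkWinding_eq_of_walk_closed Ψ ωY fun z hz => hΨY z (hωY z hz)
  -- assemble
  apply hjump
  have hFN : cornerFace (btour A (x, d) 0) = cornerFace (btour A (x, d) N) := by rw [hN, btour_zero]
  rw [hFN, harc2 N (by omega) le_rfl, ← harc2 m₄ h34 h4N.le, ← harc1 m₂ h02 h23.le, hcontact m₂ h2,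
    hcontact m₄ h4]
  exact hYw.symm

/-! ### The registered stub -/

/-- **Registered stub (witness unit U2): no `abab` alternation of two obstacle classes along the wall-follower
tour.**  For a `4`-connected site set `A`, disjoint `4`-connected obstacle classes `X, Y ⊆ ℤ² ∖ A`, and tour
positions `n₁ < n₂ < n₃ < n₄ < n₁ + N` within one injective period `N`, the contacts cannot read `X, Y, X, Y`
(discrete planar topology by the combinatorial winding number `walkWinding`). [folklore] -/
theorem btour_abab : ∀ (A : Finset (Site 2)) (X Y : Set (Site 2)) (e₀ : Site 2 × ODir) (n₁ n₂ n₃ n₄ N : ℕ), IsBEdge (↑A : Set (Site 2)) e₀ → (∀ x ∈ A, ∀ y ∈ A, ∃ p : (zdGraph 2).Walk x y, ∀ z ∈ p.support, z ∈ A) → (∀ x ∈ X, x ∉ (↑A : Set (Site 2))) → (∀ y ∈ Y, y ∉ (↑A : Set (Site 2))) → Disjoint X Y → (∀ x ∈ X, ∀ x' ∈ X, ∃ p : (zdGraph 2).Walk x x', ∀ z ∈ p.support, z ∈ X) → (∀ y ∈ Y, ∀ y' ∈ Y, ∃ p : (zdGraph 2).Walk y y', ∀ z ∈ p.support, z ∈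 Y) → n₁ < n₂ → n₂ < n₃ → n₃ < n₄ → n₄ < n₁ + N → btour (↑A : Set (Site 2)) e₀ N = e₀ → (∀ j j', j < N → j' < N → btour (↑A : Set (Site 2)) e₀ j = btour (↑A : Set (Site 2)) e₀ j' → j = j') → bcontact (btour (↑A : Set (Site 2)) e₀ n₁) ∈ X → bcontact (btour (↑A : Set (Site 2)) e₀ n₂) ∈ Y → bcontact (btour (↑A : Set (Site 2)) e₀ n₃) ∈ X → bcontact (btour (↑A : Set (Site 2)) e₀ n₄) ∈ Y → False := by
  intro A X Y e₀ n₁ n₂ n₃ n₄ N he₀ hA hXA hYA hXY hX hY h12 h23 h34 h4N hN hinj h1 h2 h3 h4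
  have hNpos : 0 < N := by omega
  -- shift the start of the period to the first `X`-position
  have hshift : ∀ k, btour (↑A : Set (Site 2)) (btour (↑A : Set (Site 2)) e₀ n₁) k =
      btour (↑A : Set (Site 2)) e₀ (n₁ + k) := fun k => (btour_add _ e₀ n₁ k).symm
  have h2' : n₁ + (n₂ - n₁) = n₂ := by omega
  have h3' : n₁ + (n₃ - n₁) = n₃ := by omega
  have h4' : n₁ + (n₄ - n₁) = n₄ := by omega
  refine abab_core (↑A : Set (Site 2)) X Y (btour (↑A : Set (Site 2)) e₀ n₁) (n₂ - n₁) (n₃ - n₁) (n₄ - n₁) N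
    (btour_isBEdge _ he₀ n₁) (fun x hx y hy => hA x hx y hy) hXA hYA hXY hX hY (by omega) (by omega)
    (by omega) (by omega) ?_ ?_ h1 ?_ ?_ ?_
  · rw [hshift, btour_add_of_eq _ hN]
  · intro j j' hj hj' h
    rw [hshift, hshift, ← btour_mod_of_eq _ hN (n₁ + j), ← btour_mod_of_eq _ hN (n₁ + j')] at h
    have hmod : j % N = j' % N :=
      Nat.ModEq.add_left_cancel' n₁ (hinj _ _ (Nat.mod_lt _ hNpos) (Nat.mod_lt _ hNpos) h)
    rwa [Nat.mod_eq_of_lt hj, Nat.mod_eq_of_lt hj'] at hmod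
  · rw [hshift, h2']; exact h2
  · rw [hshift, h3']; exact h3
  · rw [hshift, h4']; exact h4

end Summit.CriticalPhenomena.SAWScalingLimit.Theorems.FKGToTraversalBound.SlitNecklace

end
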